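import Summits.AtomisticToContinuum.Crystallization.Theorems.ChargedEnergyGap.Negative.Unconditional
import Summits.AtomisticToContinuum.Crystallization.Theorems.TransitiveLocalLimit.Negative.StubSuperBoundSparse
import Literature.MathematicalPhysics.StatisticalMechanics.Yuhjtman2015Stability

/-!
# Stub `stub_coreHeight` of line `merge-perron`, crux `PerronTransitivity.NoFractionalGain`
(stmt-AtomisticToContinuum-15098, route `PerronTransitivity`)

THE REPULSIVE CORE IS AT LEAST `-2E*` HIGH ON `(0, 73/100]`: for `0 < r ≤ 73/100`,
`-2 · ⨅_Q e_LJ(Q) ≤ V_LJ(r)`.  Two elementary halves: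

* `E* = ⨅_Q e_LJ(Q) ≥ -14.316/12`, from the PROVED stability bound
  `Yuhjtman2015_stabilityConstant_holds` (`E(N) ≥ -(14.316/12)·N`) and the PROVED limit
  `ChargedEnergyGapNegative.crysEnergyLimit` (`E(N)/N → E*`), hence `-2E* ≤ 2.386`; this half is
  the LANDED `TransitiveLocalLimit.Negative.StubSuperBoundSparse.neg_le_iInf`, reused verbatim;
* with `u = r⁻⁶ ≥ (100/73)⁶ > 6.6`, `V_LJ(r) = u²/12 - u/6 ≥ 6.6²/12 - 6.6/6 = 2.53`
  (`t ↦ t²/12 - t/6` is increasing on `t ≥ 1`).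
-/

noncomputable section

namespace Summit.AtomisticToContinuum.Crystallization.Theorems.PerronTransitivity.NoFractionalGain

open Literature.MathematicalPhysics.StatisticalMechanics
open Summit.AtomisticToContinuum.Crystallization.Theorems.TransitiveLocalLimit.Negative.StubSuperBoundSparse
  (neg_le_iInf)

/-- The repulsive core: for `0 < r ≤ 73/100`, `2·(14.316/12) = 2.386 ≤ 2.53 ≤ V_LJ(r)`; with
`u = r⁻⁶ ≥ (100/73)⁶ > 6.6` one has `V_LJ(r) = u²/12 - u/6 ≥ 6.6²/12 - 6.6/6`. [folklore] -/
theorem two_mul_stabilityConstant_le_lennardJones {r : ℝ} (hr : 0 < r) (hr' : r ≤ 73 / 100) :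
    (2 * (14.316 / 12) : ℝ) ≤ lennardJones r := by
  unfold lennardJones
  have hinv : (100 / 73 : ℝ) ≤ r⁻¹ :=
    calc (100 / 73 : ℝ) = (73 / 100)⁻¹ := by norm_num
      _ ≤ r⁻¹ := inv_anti₀ hr hr'
  have h6 : (100 / 73 : ℝ) ^ 6 ≤ (r⁻¹) ^ 6 := pow_le_pow_left₀ (by norm_num) hinv 6
  have hu : (66 / 10 : ℝ) ≤ (r⁻¹) ^ 6 := le_trans (by norm_num) h6
  have h12 : (r⁻¹) ^ 12 = ((r⁻¹) ^ 6) ^ 2 := by ring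
  rw [h12]
  nlinarith [hu, sq_nonneg ((r⁻¹) ^ 6 - 66 / 10)]

/-- **Stub `stub_coreHeight` (line `merge-perron`, crux `NoFractionalGain`,
stmt-AtomisticToContinuum-15098).**  On `(0, 73/100]` the Lennard-Jones core is at least `-2E*`
high, `E* = ⨅_Q e_LJ(Q)` the periodic infimum: `-2E* ≤ 2·(14.316/12) ≤ V_LJ(r)` by the landed
`StubSuperBoundSparse.neg_le_iInf` (`-14.316/12 ≤ E*`) and
`two_mul_stabilityConstant_le_lennardJones`. [folklore] -/
theorem stub_coreHeight : ∀ r : ℝ, 0 < r → r ≤ 73 / 100 →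
    -2 * (⨅ Q : PeriodicConfiguration 3, Q.energyPerParticle lennardJones) ≤ lennardJones r := by
  intro r hr hr'
  have h1 := neg_le_iInf
  have h2 := two_mul_stabilityConstant_le_lennardJones hr hr'
  linarith

end Summit.AtomisticToContinuum.Crystallization.Theorems.PerronTransitivity.NoFractionalGain

end
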